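import Summits.QuantumFields.YangMills.Theorems.FluctuationComparisonRegPrIntLOrganTangentCovSandwich
import HarnessLib

/-!
# Crux `FluctuationComparisonRegPrIntL` (stmt-QuantumFields-20520, rung R3), PATH-B organ, JENSEN SIDE — DISCHARGE SPEC v1.4 §9 «sq» PROGRAMME, (sq3) «(I-cov)sq»:
# **«COV-SANDWICH-sq»** — the NEAR-PAIR editions of ✓`…OrganTangentCovSandwich`'s two doors (✓p816302): the profile predicate is INDEXED BY THE LAW POINT
# and the transport ∕ flat profiles are stated PER ADMISSIBLE SQUARE with the law point a CORNER of that square, DEFINITION-FREE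

Cell `ym3-torus` (rung R3 = continuum `SU(2)` Yang–Mills on T³ — NOT d = 4, NOT infinite volume, NOT a mass gap, NOT Clay), width copy `ym3-torus-px5` (gen 21;
LEAD `ym-ust-20520-w3` g26 №38 ∕ №40, DISCHARGE-SPEC v1.4 §9 «(sq3) … (I-cov) (G)+(K0) relative to the law square (px5-lineage)»; w4 g24 TN-HGLOB-FRAME §6 and
INSTANCE TABLE §2 ∕ §4 ∕ §5).  `--kind proof --supports stmt-QuantumFields-20520 --as helper`, count-neutral, DEF-FREE, default heartbeats, `autoImplicit false`;
no registry ∕ binder ∕ `Lines/` edit.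

WHY.  The frozen row `SpreadFibreLawHJ` (✓`…RunpairOrganFibreLawJDefs`) quantifies the LAW point `Xw` of its (JV1-h) ∕ (JV2-h) conjuncts over the whole
`θ_j∕4`-window independently of the observable's admissible square `U V W Y`, and ✓p816302's hypothesis letters follow suit: its profile predicate
`Prof : (Z → ℝ) → (ι → ℝ) → Prop` is law-point-BLIND and its flat profile (K0) is asked of `F_X` for EVERY window point `X` — so the covariance-kernel clause (G),
read at a law point `Xw` against `F_X` with `X` FAR from `Xw`, silently carries the far-pair square-stability debt (`Integrable (F_X·ŵ_t(Xw))`; INSTANCE TABLE §2 last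
row, §4).  Every CONSUMER instantiates NEAR pairs only (Jensen knit ✓p814161 :243 `Xw := Y`, :249–252 `X ∈ {U,V,W,Y}`), and for FAR pairs the window-to-window
transport term is not dischargeable in print's frames (TN-HGLOB-FRAME §4–§5).  The «sq» programme restates every clause for near pairs; THIS FILE is the (I-cov) side.

WHAT (same abstract setting as ✓p816302: one fibre `(Z, τ)`, coarse fields `GaugeField P j SU(2)`, one-bond moves `U ↦ U·expPt m @ B`, window `PlaqSmall θc`, sizes
`‖m‖∕θc`, abstract corner values `Fobs` and laws `Law`, fine index type `ι`; THREE HYPOTHESIS LETTERS, none proved here, each a PURE RE-INDEXING of ✓p816302's):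
* (P)sq a LAW-INDEXED PROFILE PREDICATE `Prof : GaugeField P j SU(2) → (Z → ℝ) → (ι → ℝ) → Prop` — «`A` has fine profile `p` RELATIVE TO the law at `Xw`» (the
  discharger defines it through ITS chart at `Xw` and may put the `ŵ_t(Xw)`-integrability ∕ stability of `A` inside; this file never looks inside);
* (G)sq «COV-KERNEL», t-UNIFORM, AT EACH LAW POINT FOR OBSERVABLES PROFILED AT THAT LAW POINT: `… ∀ Xw, PlaqSmall θc Xw → ∀ Pf Qf p q, Prof Xw Pf p → Prof Xw Qf q →`
  (`Integrable` conjunct ∧ `|Cov_{ŵ_t(Xw)}(Pf, Qf)| ≤ Σ_{a,c} |p a|·𝒢 a c·|q c|`) — otherwise character-equal to ✓p816302's (G); ONE kernel `𝒢 ≥ 0` with weighted ∕ plain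
  row masses `NG` ∕ `NG₀` (Brascamp–Lieb ∕ Helffer–Sjöstrand SHAPE; print: [Balaban1984PropagatorsII], [Balaban1985UV3] for `𝒢`, [Balaban1988RG2Cluster] Lemma 3);
* (K1)sq ∕ (K2)sq ∕ (K0)sq TRANSPORT ∕ FLAT PROFILES PER ADMISSIBLE SQUARE, RELATIVE TO ITS FOURTH CORNER: for every admissible square `(U, V = U^{B,m},
  W = U^{B′,m′}, Y = V^{B′,m′})` (`‖m‖, ‖m′‖ ≤ rc·θc`, all corners in the window) — (K1)sq `Prof Y (F_V − F_U) ((‖m‖∕θc)·K(·,B)) ∧ Prof Y (F_W − F_U) ((‖m′‖∕θc)·K(·,B′))`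
  (BOTH edges at `U` in one clause: the transposed-square symmetry fails at `B = B′` because `expPt m`, `expPt m′` need not commute, so the `B′`-edge is stated, not
  derived); (K2)sq `Prof Y (ΔΔF) ((‖m‖∕θc)(‖m′‖∕θc)·K2(·,B,B′))`; (K0)sq `Prof Y (F_X) (fun _ => x₀)` for `X` a corner (`PlaqSmall θc X → (X = U ∨ X = V ∨ X = W ∨ X = Y) →`,
  the (JV1-h)sq prefix verbatim) — NO window-wide `∀ X`; the law point is the fourth corner `Y`, exactly as (sq1) `SpreadFibreLawHJsq` spells (JV1-h)sq ∕ (JV2-h)sq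
  (w4 g24, LEAD №40 «`Xw` replaced by the corner rôle the consumers use»); letters `K ωX Ncol Nrow`, `K2 NY`, `x₀`, the triangle `htri` and the two budgets
  `Ncol·NG·Nrow ≤ M`, `x₀·NG₀·NY ≤ M` UNCHANGED ([Balaban1985Variational] Thm 1 (9)–(10), Prop 9 (190) is where such letters come from — LOCATE only).
* law facts for (JV1-h)sq's free re-centring: the (JV0-h)sq clause SHAPE verbatim (`hJV0`: normalisation of `ŵ_t(Xw)` and `ŵ_t(Xw)`-integrability of `F_X`, `F_X²`
  for CORNER PAIRS `(X, Xw)` of one admissible square), read at `(X, Y)` — so the knit-sq passes its (JV0-h)sq term unchanged.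
CONCLUSIONS = the (JV1-h)sq ∕ (JV2-h)sq clause SHAPES of `SpreadFibreLawHJsq` (value point `X` a corner by `X = U ∨ X = V ∨ X = W ∨ X = Y`, law `ŵ_t(Y)`);
`kV₂ B B′ := Σ_{a,c} K a B·𝒢 a c·K c B′` (row mass ✓`rowMass_sandwich_le`), `kV₁ B B′ := x₀·Σ_a (Σ_c 𝒢 a c)·K2 a B B′` (✓`rowMass_gradient_le`) — the SAME letters as
✓p816302, and the proofs are ✓p816302's with the corner passed to `Prof` (its §0 algebra `sandwich_abs_sizes_eq` ∕ `gradient_abs_sizes_eq` ∕ `integral_mul_centred_eq_cov`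
is imported, not restated).  A consumer instantiates `Fobs := fun X z => log ρ_Ts (Φ (X,z)) − log ρ′_Ts (Φ (X,z))`, `Law := fun t Xw z => wgt … t Xw z`, `θc := θBal_j∕4`,
`M := NV•·Dr·w·(w∕D_Ts) + δV• j·D_j` and closes the (JV1-h)sq ∕ (JV2-h)sq conjuncts of `SpreadFibreLawHJsq` by `exact` (DOCK twin against w4 g24's (sq1) bytes in HOME `ym3-torus-px5/g21/`).

HONEST FRAMING: bookkeeping over HYPOTHESIS letters ([folklore] algebra); (P)(G)(K0)(K1)(K2)sq are exactly as OPEN as (JV1-h)(JV2-h)sq — weaker than their «b»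
originals only in WHERE they are asked (near pairs), not in what is proved (nothing); nothing of Bałaban's analysis is asserted or proved; `SpreadFibreLawH(J)`,
`OrganDischargeInputsHJ` and their sq editions remain hypothesis rows; JVAR″, JEN″, LIN″, O1ᵘ-H v2.2, S1aᴴ, S3ᴴ, S2β, the five registered stubs, crux 20520 and
`YM3TorusSU2` are NOT proved; registry `Lines/semiclassical_s2beta.lean` and `Lines/runpair_organ.lean` untouched, nothing here is registered; rung R3 = SU(2) YM₃ on
T³ — NOT d = 4, NOT infinite volume, NOT a mass gap, NOT Clay; the Yang–Mills mass gap is NOT proved by any of this.  Credit: LEAD w3 g26 (№38∕№40, SPEC v1.4 §9),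
w4 g24 (TN-HGLOB-FRAME, INSTANCE TABLE), px5 g20 (✓p816302), px19 g20 (letters), instr-1 g14 (FL-29∕FL-34).
-/

set_option autoImplicit false

noncomputable section

namespace Summit.QuantumFields.YangMills.Theorems.OrganTangentCovSandwichSq

open MeasureTheory
open scoped BigOperators
open Literature.MathematicalPhysics.QuantumFieldTheory.Balaban1983to89 T3ContinuumYM3Torus T3NestedUnitLaws
  T3UnitLawDensityEML T4Continuum BalabanUVClass T3UnitScaleTilt T3LevelShift T3TiltDescent
open T4CubeChartExp (expPt)
open Summit.QuantumFields.YangMills.Theorems.OrganTangentPullbackRowMass (rowMass_sandwich_le rowMass_gradient_le)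
open Summit.QuantumFields.YangMills.Theorems.OrganTangentCovSandwich (sandwich_abs_sizes_eq gradient_abs_sizes_eq integral_mul_centred_eq_cov)

variable {P : Params} {j : ℕ} {ι : Type*} [Fintype ι] {Z : Type*} [MeasurableSpace Z]

/-! ## §1 (JV2-h)sq from the law-indexed covariance kernel and the per-square first-order transport profiles (law point `Y`) -/

/-- ★★ **(JV2-h)sq ⟸ COV-KERNEL × TRANSPORT PROFILES, NEAR-PAIR EDITION** (the clause SHAPE of `SpreadFibreLawHJsq`'s (JV2-h) conjunct: law point = the fourth
corner `Y` of the observable's admissible square).  `kV₂ B B′ := Σ_{a,c} K a B·𝒢 a c·K c B′`, row mass ✓`rowMass_sandwich_le` (`≤ Ncol·NG·Nrow ≤ M`). [folklore] -/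
theorem jv2ClauseSq_of_covKernel_profiles (τ : Measure Z) (Fobs : GaugeField P j ↥(Matrix.specialUnitaryGroup (Fin 2) ℂ) → Z → ℝ)
    (Law : ℝ → GaugeField P j ↥(Matrix.specialUnitaryGroup (Fin 2) ℂ) → Z → ℝ) (θc rc κ M : ℝ) (hθc : 0 < θc)
    (Prof : GaugeField P j ↥(Matrix.specialUnitaryGroup (Fin 2) ℂ) → (Z → ℝ) → (ι → ℝ) → Prop)
    -- (G)sq the covariance kernel AT each window law point, for observables profiled AT that law point, t-uniform
    (𝒢 : ι → ι → ℝ) (ωf : ι → ι → ℝ) (NG : ℝ) (hG0 : ∀ a c, 0 ≤ 𝒢 a c) (hωf : ∀ a c, 0 ≤ ωf a c) (hNG : 0 ≤ NG)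
    (hGrow : ∀ a, ∑ c, 𝒢 a c * ωf a c ≤ NG)
    (hCov : ∀ t : ℝ, 0 ≤ t → t ≤ 1 → ∀ Xw : GaugeField P j ↥(Matrix.specialUnitaryGroup (Fin 2) ℂ), PlaqSmall θc Xw →
      ∀ (Pf Qf : Z → ℝ) (p q : ι → ℝ), Prof Xw Pf p → Prof Xw Qf q → ∀ (cP cQ : ℝ),
        cP = ∫ z, Pf z * Law t Xw z ∂τ → cQ = ∫ z, Qf z * Law t Xw z ∂τ →
          Integrable (fun z => (Pf z - cP) * (Qf z - cQ) * Law t Xw z) τ ∧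
            |∫ z, (Pf z - cP) * (Qf z - cQ) * Law t Xw z ∂τ| ≤ ∑ a, ∑ c, |p a| * 𝒢 a c * |q c|)
    -- (K1)sq the first-order transport profiles of the two edges at `U` of an admissible square, relative to its fourth corner `Y`
    (K : ι → PBond P j → ℝ) (ωX : ι → PBond P j → ℝ) (Ncol Nrow : ℝ) (hK0 : ∀ a B, 0 ≤ K a B) (hωX : ∀ a B, 0 ≤ ωX a B)
    (hNrow : 0 ≤ Nrow) (hKcol : ∀ B, ∑ a, K a B * ωX a B ≤ Ncol) (hKrow : ∀ c, ∑ B', K c B' * ωX c B' ≤ Nrow)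
    (htri : ∀ (B B' : PBond P j) (a c : ι), Real.exp (κ * (B.src.tdist B'.src : ℝ)) ≤ ωX a B * ωf a c * ωX c B')
    (hProf1 : ∀ (B B' : PBond P j) (m m' : Fin 3 → ℝ) (U V W Y : GaugeField P j ↥(Matrix.specialUnitaryGroup (Fin 2) ℂ)),
      ‖m‖ ≤ rc * θc → ‖m'‖ ≤ rc * θc → PlaqSmall θc U → PlaqSmall θc V → PlaqSmall θc W → PlaqSmall θc Y →
      (∀ e, e ≠ B → V e = U e) → V B = U B * expPt m → (∀ e, e ≠ B' → W e = U e) → W B' = U B' * expPt m' →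
      (∀ e, e ≠ B' → Y e = V e) → Y B' = V B' * expPt m' →
        Prof Y (fun z => Fobs V z - Fobs U z) (fun a => ‖m‖ / θc * K a B) ∧
          Prof Y (fun z => Fobs W z - Fobs U z) (fun a => ‖m'‖ / θc * K a B'))
    (hM : Ncol * NG * Nrow ≤ M) :
    ∃ kV₂ : PBond P j → PBond P j → ℝ, (∀ B B', 0 ≤ kV₂ B B') ∧
      (∀ B, ∑ B', kV₂ B B' * Real.exp (κ * (B.src.tdist B'.src : ℝ)) ≤ M) ∧
      ∀ t : ℝ, 0 ≤ t → t ≤ 1 → (∀ (B B' : PBond P j) (m m' : Fin 3 → ℝ)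
        (U V W Y : GaugeField P j ↥(Matrix.specialUnitaryGroup (Fin 2) ℂ)),
        ‖m‖ ≤ rc * θc → ‖m'‖ ≤ rc * θc → PlaqSmall θc U → PlaqSmall θc V → PlaqSmall θc W → PlaqSmall θc Y →
        (∀ e, e ≠ B → V e = U e) → V B = U B * expPt m → (∀ e, e ≠ B' → W e = U e) → W B' = U B' * expPt m' →
        (∀ e, e ≠ B' → Y e = V e) → Y B' = V B' * expPt m' →
        ∀ (c₁ c₂ : ℝ), c₁ = ∫ z, (Fobs V z - Fobs U z) * Law t Y z ∂τ → c₂ = ∫ z, (Fobs W z - Fobs U z) * Law t Y z ∂τ →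
          Integrable (fun z => ((Fobs V z - Fobs U z) - c₁) * ((Fobs W z - Fobs U z) - c₂) * Law t Y z) τ ∧
          |∫ z, ((Fobs V z - Fobs U z) - c₁) * ((Fobs W z - Fobs U z) - c₂) * Law t Y z ∂τ|
            ≤ kV₂ B B' * (‖m‖ / θc) * (‖m'‖ / θc)) := by
  refine ⟨fun B B' => ∑ a, ∑ c, K a B * 𝒢 a c * K c B', fun B B' => ?_, fun B => ?_, ?_⟩
  · exact Finset.sum_nonneg fun a _ => Finset.sum_nonneg fun c _ => mul_nonneg (mul_nonneg (hK0 a B) (hG0 a c)) (hK0 c B')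
  · exact (rowMass_sandwich_le 𝒢 K ωf (fun B B' => Real.exp (κ * (B.src.tdist B'.src : ℝ))) ωX hG0 hK0 hωf hωX htri hNG hNrow
      hKcol hKrow hGrow B).trans hM
  · intro t ht0 ht1 B B' m m' U V W Y hm hm' hU hV hW hY hVU hVB hWU hWB hYV hYB c₁ c₂ hc₁ hc₂
    obtain ⟨hp, hq⟩ := hProf1 B B' m m' U V W Y hm hm' hU hV hW hY hVU hVB hWU hWB hYV hYB
    obtain ⟨hint, hbd⟩ := hCov t ht0 ht1 Y hY _ _ _ _ hp hq c₁ c₂ hc₁ hc₂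
    refine ⟨hint, hbd.trans (le_of_eq ?_)⟩
    exact sandwich_abs_sizes_eq K 𝒢 hK0 B B' (div_nonneg (norm_nonneg _) hθc.le) (div_nonneg (norm_nonneg _) hθc.le)

/-! ## §2 (JV1-h)sq from the law-indexed covariance kernel, the per-square second-order transport profile and the per-square flat corner profiles (law point `Y`) -/

/-- ★★ **(JV1-h)sq ⟸ COV-KERNEL × TRANSPORT PROFILES, NEAR-PAIR EDITION** (the clause SHAPE of `SpreadFibreLawHJsq`'s (JV1-h) conjunct: value point `X` a corner,
law point `Y`).  The law facts are taken as the (JV0-h)sq clause SHAPE verbatim (`hJV0`, read at the corner pair `(X, Y)`); the un-centred left factor `ΔΔF` is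
re-centred for free against the normalised law; `kV₁ B B′ := x₀·Σ_a (Σ_c 𝒢 a c)·K2 a B B′`, row mass ✓`rowMass_gradient_le` (`≤ (x₀·NG₀)·NY ≤ M`). [folklore] -/
theorem jv1ClauseSq_of_covKernel_profiles (τ : Measure Z) (Fobs : GaugeField P j ↥(Matrix.specialUnitaryGroup (Fin 2) ℂ) → Z → ℝ)
    (Law : ℝ → GaugeField P j ↥(Matrix.specialUnitaryGroup (Fin 2) ℂ) → Z → ℝ) (θc rc κ M : ℝ) (hθc : 0 < θc)
    (Prof : GaugeField P j ↥(Matrix.specialUnitaryGroup (Fin 2) ℂ) → (Z → ℝ) → (ι → ℝ) → Prop)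
    -- (JV0-h)sq, the clause SHAPE verbatim: normalisation and moments at corner pairs of one admissible square
    (hJV0 : ∀ t : ℝ, 0 ≤ t → t ≤ 1 → ∀ (B B' : PBond P j) (m m' : Fin 3 → ℝ) (U V W Y X Xw : GaugeField P j ↥(Matrix.specialUnitaryGroup (Fin 2) ℂ)),
      ‖m‖ ≤ rc * θc → ‖m'‖ ≤ rc * θc → PlaqSmall θc U → PlaqSmall θc V → PlaqSmall θc W → PlaqSmall θc Y →
      PlaqSmall θc X → PlaqSmall θc Xw →
      (∀ e, e ≠ B → V e = U e) → V B = U B * expPt m → (∀ e, e ≠ B' → W e = U e) → W B' = U B' * expPt m' →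
      (∀ e, e ≠ B' → Y e = V e) → Y B' = V B' * expPt m' →
      (X = U ∨ X = V ∨ X = W ∨ X = Y) → (Xw = U ∨ Xw = V ∨ Xw = W ∨ Xw = Y) →
        Integrable (fun z => Law t Xw z) τ ∧ ∫ z, Law t Xw z ∂τ = 1 ∧
          Integrable (fun z => Fobs X z * Law t Xw z) τ ∧ Integrable (fun z => Fobs X z ^ 2 * Law t Xw z) τ)
    -- (G)sq the covariance kernel AT each window law point (unweighted row mass `NG₀` is what (JV1-h) needs)
    (𝒢 : ι → ι → ℝ) (NG₀ : ℝ) (hG0 : ∀ a c, 0 ≤ 𝒢 a c) (hNG₀ : 0 ≤ NG₀) (hGrow₀ : ∀ a, ∑ c, 𝒢 a c ≤ NG₀)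
    (hCov : ∀ t : ℝ, 0 ≤ t → t ≤ 1 → ∀ Xw : GaugeField P j ↥(Matrix.specialUnitaryGroup (Fin 2) ℂ), PlaqSmall θc Xw →
      ∀ (Pf Qf : Z → ℝ) (p q : ι → ℝ), Prof Xw Pf p → Prof Xw Qf q → ∀ (cP cQ : ℝ),
        cP = ∫ z, Pf z * Law t Xw z ∂τ → cQ = ∫ z, Qf z * Law t Xw z ∂τ →
          Integrable (fun z => (Pf z - cP) * (Qf z - cQ) * Law t Xw z) τ ∧
            |∫ z, (Pf z - cP) * (Qf z - cQ) * Law t Xw z ∂τ| ≤ ∑ a, ∑ c, |p a| * 𝒢 a c * |q c|)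
    -- (K2)sq the second-order transport profile of the square's `ΔΔF`, relative to its fourth corner `Y`
    (K2 : ι → PBond P j → PBond P j → ℝ) (NY : ℝ) (hK20 : ∀ a B B', 0 ≤ K2 a B B')
    (hK2mass : ∀ B, ∑ a, ∑ B', K2 a B B' * Real.exp (κ * (B.src.tdist B'.src : ℝ)) ≤ NY)
    (hProf2 : ∀ (B B' : PBond P j) (m m' : Fin 3 → ℝ) (U V W Y : GaugeField P j ↥(Matrix.specialUnitaryGroup (Fin 2) ℂ)),
      ‖m‖ ≤ rc * θc → ‖m'‖ ≤ rc * θc → PlaqSmall θc U → PlaqSmall θc V → PlaqSmall θc W → PlaqSmall θc Y →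
      (∀ e, e ≠ B → V e = U e) → V B = U B * expPt m → (∀ e, e ≠ B' → W e = U e) → W B' = U B' * expPt m' →
      (∀ e, e ≠ B' → Y e = V e) → Y B' = V B' * expPt m' →
        Prof Y (fun z => Fobs Y z - Fobs V z - Fobs W z + Fobs U z) (fun a => ‖m‖ / θc * (‖m'‖ / θc) * K2 a B B'))
    -- (K0)sq the flat profile of every corner value `F_X`, relative to the fourth corner `Y` (prefix = (JV1-h)sq's, verbatim)
    (x₀ : ℝ) (hx₀ : 0 ≤ x₀)
    (hProf0 : ∀ (B B' : PBond P j) (m m' : Fin 3 → ℝ) (U V W Y X : GaugeField P j ↥(Matrix.specialUnitaryGroup (Fin 2) ℂ)),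
      ‖m‖ ≤ rc * θc → ‖m'‖ ≤ rc * θc → PlaqSmall θc U → PlaqSmall θc V → PlaqSmall θc W → PlaqSmall θc Y →
      PlaqSmall θc X → (X = U ∨ X = V ∨ X = W ∨ X = Y) →
      (∀ e, e ≠ B → V e = U e) → V B = U B * expPt m → (∀ e, e ≠ B' → W e = U e) → W B' = U B' * expPt m' →
      (∀ e, e ≠ B' → Y e = V e) → Y B' = V B' * expPt m' →
        Prof Y (fun z => Fobs X z) (fun _ => x₀))
    (hM : x₀ * NG₀ * NY ≤ M) :
    ∃ kV₁ : PBond P j → PBond P j → ℝ, (∀ B B', 0 ≤ kV₁ B B') ∧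
      (∀ B, ∑ B', kV₁ B B' * Real.exp (κ * (B.src.tdist B'.src : ℝ)) ≤ M) ∧
      ∀ t : ℝ, 0 ≤ t → t ≤ 1 → (∀ (B B' : PBond P j) (m m' : Fin 3 → ℝ)
        (U V W Y X : GaugeField P j ↥(Matrix.specialUnitaryGroup (Fin 2) ℂ)),
        ‖m‖ ≤ rc * θc → ‖m'‖ ≤ rc * θc → PlaqSmall θc U → PlaqSmall θc V → PlaqSmall θc W → PlaqSmall θc Y →
        PlaqSmall θc X → (X = U ∨ X = V ∨ X = W ∨ X = Y) →
        (∀ e, e ≠ B → V e = U e) → V B = U B * expPt m → (∀ e, e ≠ B' → W e = U e) → W B' = U B' * expPt m' →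
        (∀ e, e ≠ B' → Y e = V e) → Y B' = V B' * expPt m' →
        ∀ (c : ℝ), c = ∫ z, Fobs X z * Law t Y z ∂τ →
          Integrable (fun z => (Fobs Y z - Fobs V z - Fobs W z + Fobs U z) * (Fobs X z - c) * Law t Y z) τ ∧
          |∫ z, (Fobs Y z - Fobs V z - Fobs W z + Fobs U z) * (Fobs X z - c) * Law t Y z ∂τ|
            ≤ kV₁ B B' * (‖m‖ / θc) * (‖m'‖ / θc)) := by
  refine ⟨fun B B' => x₀ * ∑ a, (∑ c, 𝒢 a c) * K2 a B B', fun B B' => ?_, fun B => ?_, ?_⟩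
  · exact mul_nonneg hx₀ (Finset.sum_nonneg fun a _ => mul_nonneg (Finset.sum_nonneg fun c _ => hG0 a c) (hK20 a B B'))
  · have h := rowMass_gradient_le (fun a => x₀ * ∑ c, 𝒢 a c) K2 (fun B B' => Real.exp (κ * (B.src.tdist B'.src : ℝ)))
      hK20 (fun B B' => (Real.exp_pos _).le) (mul_nonneg hx₀ hNG₀) (fun a => mul_le_mul_of_nonneg_left (hGrow₀ a) hx₀) hK2mass B
    refine le_trans (le_of_eq (Finset.sum_congr rfl fun B' _ => ?_)) (h.trans hM)
    beta_reduce
    rw [Finset.mul_sum]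
    congr 1
    exact Finset.sum_congr rfl fun a _ => by ring
  · intro t ht0 ht1 B B' m m' U V W Y X hm hm' hU hV hW hY hX hcorX hVU hVB hWU hWB hYV hYB c hc
    have hp := hProf2 B B' m m' U V W Y hm hm' hU hV hW hY hVU hVB hWU hWB hYV hYB
    have hq := hProf0 B B' m m' U V W Y X hm hm' hU hV hW hY hX hcorX hVU hVB hWU hWB hYV hYB
    obtain ⟨hWi, hWn, hFX, -⟩ := hJV0 t ht0 ht1 B B' m m' U V W Y X Y hm hm' hU hV hW hY hX hY hVU hVB hWU hWB hYV hYB hcorX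
      (Or.inr (Or.inr (Or.inr rfl)))
    obtain ⟨hint, hbd⟩ := hCov t ht0 ht1 Y hY (fun z => Fobs Y z - Fobs V z - Fobs W z + Fobs U z) (fun z => Fobs X z)
      (fun a => ‖m‖ / θc * (‖m'‖ / θc) * K2 a B B') (fun _ => x₀) hp hq
      (∫ z, (Fobs Y z - Fobs V z - Fobs W z + Fobs U z) * Law t Y z ∂τ) c rfl hc
    obtain ⟨hint2, heq⟩ := integral_mul_centred_eq_cov τ (fun z => Fobs Y z - Fobs V z - Fobs W z + Fobs U z) (fun z => Fobs X z)
      (Law t Y) (∫ z, (Fobs Y z - Fobs V z - Fobs W z + Fobs U z) * Law t Y z ∂τ) c hWi hWn hFX hc hint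
    have heq' : ∫ z, (Fobs Y z - Fobs V z - Fobs W z + Fobs U z) * (Fobs X z - c) * Law t Y z ∂τ
        = ∫ z, ((Fobs Y z - Fobs V z - Fobs W z + Fobs U z) - ∫ z, (Fobs Y z - Fobs V z - Fobs W z + Fobs U z) * Law t Y z ∂τ)
            * (Fobs X z - c) * Law t Y z ∂τ := heq
    refine ⟨hint2, ?_⟩
    rw [heq']
    refine hbd.trans (le_of_eq ?_)
    exact gradient_abs_sizes_eq (fun a => K2 a B B') 𝒢 (fun a => hK20 a B B')
      (div_nonneg (norm_nonneg _) hθc.le) (div_nonneg (norm_nonneg _) hθc.le) hx₀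

end Summit.QuantumFields.YangMills.Theorems.OrganTangentCovSandwichSq

end
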